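import Literature.NumberTheory.EllipticCurves.HasseWeilAbelianBadReduction
import Literature.NumberTheory.EllipticCurves.HasseWeilGoodReductionFrobenius
import Literature.NumberTheory.EllipticCurves.SingularCubic
import Literature.NumberTheory.EllipticCurves.TateModuleRank
import Literature.NumberTheory.EllipticCurves.TateModuleContinuityProofs
import Mathlib.RingTheory.RootsOfUnity.AlgebraicallyClosed
import HarnessLib

/-!
# The schemas `hasseWeilEulerFactor_geomPoints`, `hasRationalEulerFactors_geomPoints` fail on
split nodal cubics (proved refutation), via the Euler factor of `V_ℓ(K̄ˣ) = ℚ_ℓ(1)`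

Topic `EllipticCurves`, sibling of `HasseWeilAbelian` (trunk EllArithM, item C15),
`HasseWeilAbelianBadReduction` and `HasseWeilAbelianRationalEulerFactors`.  Everything here is
**proved** (no `def`, no named fact).

The two named facts `WeierstrassCurve.hasseWeilEulerFactor_geomPoints W ℓ` and
`WeierstrassCurve.hasRationalEulerFactors_geomPoints W` of `HasseWeilAbelian` were produced
(D-0014 sweep) from sorried theorems stated under a section instance `[W.IsElliptic]` that a
`Prop`-valued `def` does not pick up; as schemas over **all** Weierstrass equations `W` over a
number field `K` they also assert the Euler-factor identity
`det(1 - σ_v T ∣ (V_ℓ W_ns(K̄))_{I_v}) = L_v(W, T)` for *singular* `W`.  This file proves that the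
identity is false for every **split nodal cubic**, i.e. for Silverman's singular model
`W = singularModel x₀ y₀ α₁ α₂` (`SingularCubic`: the general cubic with a singular point
`(x₀, y₀)` and tangent slopes `α₁, α₂`) with `α₁ ≠ α₂` in `K`:

* `WeierstrassCurve.not_hasseWeilEulerFactor_geomPoints_singularModel`:
  `¬ (singularModel x₀ y₀ α₁ α₂).hasseWeilEulerFactor_geomPoints ℓ` for every prime `ℓ`;
* `WeierstrassCurve.not_hasRationalEulerFactors_geomPoints_singularModel`:
  `¬ (singularModel x₀ y₀ α₁ α₂).hasRationalEulerFactors_geomPoints`.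

So the corrected statements `…_of_isElliptic` (with `[W.IsElliptic]` quantified in the body;
`HasseWeilAbelianRationalEulerFactors`, and the bad-place facts of `HasseWeilAbelianBadReduction`)
are the ones to use; conditional results taking the uncorrected schemas *for all `W`* as a
hypothesis are vacuous.

## The computation (Silverman, *AEC*, III.2.5 and Ex. 3.5; Serre, *Abelian `ℓ`-adic
representations*, I.1.2)

1. **`E_ns(K̄) ≃ K̄ˣ` equivariantly.**  `geomPoints W` is Mathlib's group of non-singular points of
   `W ⊗ K̄`, which *is* the singular model with the embedded parameters
   (`baseChange_singularModel`), and Silverman's isomorphism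
   `(x, y) ↦ (y - y₀ - α₁(x - x₀))/(y - y₀ - α₂(x - x₀))` (`singularModel.nodeEquiv`, proved in
   `SingularCubic`) has coefficients in `K`, hence commutes with `Gal(K̄/K)`
   (`exists_equivariant_addEquiv_units_geomPoints_singularModel`).
2. **The Tate module of the multiplicative group** (generic section `MultiplicativeGroup`, for any
   `Γ_K`-module `M` with an equivariant `e : M ≃ K̄ˣ`): `M[ℓⁿ] ≃ μ_{ℓⁿ}(K̄)` has `ℓⁿ` elements
   (`natCard_torsionBy_eq_of_addEquiv_units`, Mathlib `HasEnoughRootsOfUnity.natCard_rootsOfUnity`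
   in characteristic `0`), so `dim V_ℓ M = 1` (`RationalTateModule.finrank_eq_of_card_torsionBy`);
   an arithmetic Frobenius `σ` at `𝔓 ∣ v ∤ ℓ` acts on `μ_{ℓ^∞}` by `t ↦ t ^ {N v}`
   (`smul_eq_pow_residueCard_of_isArithFrobAt`, `HasseWeilGoodReductionFrobenius`) and inertia at
   `𝔓` trivially (`smul_eq_self_of_mem_inertia_of_pow_prime_pow_eq_one`, `GaloisRep`), hence on
   `T_ℓ M`, `V_ℓ M` as the scalars `N v`, `1`; the inertia coinvariants are all of `V_ℓ M`, a line
   on which `σ` is `N v`, and the Euler factor is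
   `det(1 - σ T ∣ ℚ_ℓ(1)) = 1 - (N v) T` (`hasseWeilEulerFactor_eq_of_addEquiv_units`; this is
   `χ_ℓ(Frob_v) = N v`, Serre I.1.2).
3. **Mathlib's local polynomial of a singular equation** is `1 - T`, `1 + T` or `1`
   (`localPolynomialAt_mem_of_Δ_eq_zero`: for `Δ = 0` the chosen "minimal" model has `Δ = 0`,
   never good reduction), whose coefficient of `T` is `-1`, `1` or `0`, never `-(N v)` since
   `N v ≥ 2` (`hasseWeilEulerFactor_geomPoints_singularModel_ne`).
4. Continuity and finiteness witnesses, over which the schemas quantify, exist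
   (`continuous_rationalTateRepresentation_singularModel` from
   `Literature.NumberTheory.EllipticCurves.continuous_rationalTateRepresentation`;
   `module_finite_rationalTateModule_singularModel`), and so does a place `v ∤ ℓ`
   (`exists_heightOneSpectrum_natCast_notMem`).

## References

* J. H. Silverman, *The Arithmetic of Elliptic Curves*, 2nd ed. (2009), Prop. III.2.5(a),
  Exercise 3.5, §C.16. [SilvermanAEC2009]
* J.-P. Serre, *Abelian `ℓ`-adic representations and elliptic curves* (1968), Ch. I §1.2
  (Examples: roots of unity, `χ_ℓ(F_v) = Nv`; Tate modules). [SerreAbelianLadic1968]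
* J.-P. Serre, *Facteurs locaux des fonctions zêta des variétés algébriques* (1970), §2.4 (b)
  (a torus `Y(v)` of dimension `1` has `P(T) = 1 - c_v T`; here the whole curve is the torus and the
  factor of `V_ℓ` itself is `1 - (Nv)T` in the arithmetic normalisation).

## Design

`noncomputable section`, `open scoped Classical`, one universe `u` (`K M : Type u`), as in the
sibling files; deliberate dot-notation extensions of Mathlib's `WeierstrassCurve` namespace;
generic lemmas in `Literature.NumberTheory.EllipticCurves`.  Theorems only.
-/

noncomputable section

open scoped Classical NumberField Polynomial AddSubgroup TensorProduct

open Field IsDedekindDomain Polynomial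

universe u

namespace Literature.NumberTheory.EllipticCurves

open Literature.NumberTheory.GaloisRepresentations

/-! ## A finite place away from `ℓ` -/

section Place

variable (K : Type u) [Field K] [NumberField K] (ℓ : ℕ) [Fact ℓ.Prime]

/-- Every number field has a finite place `v` with `v ∤ ℓ`: take a rational prime `p ≠ ℓ` and a
prime of `𝓞 K` above `p` (lying over for the integral extension `ℤ ⊆ 𝓞 K`). [folklore] -/
theorem exists_heightOneSpectrum_natCast_notMem :
    ∃ v : HeightOneSpectrum (𝓞 K), (ℓ : 𝓞 K) ∉ v.asIdeal := by
  obtain ⟨p, hℓp, hp⟩ := Nat.exists_infinite_primes (ℓ + 1)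
  have hpℓ : p ≠ ℓ := by omega
  haveI hP : (Ideal.span {(p : ℤ)}).IsMaximal :=
    Ideal.IsPrime.isMaximal ((Ideal.span_singleton_prime (by exact_mod_cast hp.ne_zero)).2
      (Nat.prime_iff_prime_int.1 hp)) (by simpa using hp.ne_zero)
  obtain ⟨Q, hQ, hQover⟩ :=
    Ideal.exists_maximal_ideal_liesOver_of_isIntegral (S := 𝓞 K) (Ideal.span {(p : ℤ)})
  have hunder : Q.under ℤ = Ideal.span {(p : ℤ)} := hQover.over.symm
  have hQbot : Q ≠ ⊥ := by
    intro hQ0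
    have : Ideal.span {(p : ℤ)} = ⊥ := by
      rw [← hunder, hQ0, Ideal.under_bot]
    exact (by exact_mod_cast hp.ne_zero : (p : ℤ) ≠ 0) (Ideal.span_singleton_eq_bot.1 this)
  refine ⟨⟨Q, hQ.isPrime, hQbot⟩, fun hℓ => hpℓ ?_⟩
  have hℓ' : (ℓ : ℤ) ∈ Q.under ℤ := by
    rw [Ideal.mem_under, map_natCast]; exact hℓ
  rw [hunder, Ideal.mem_span_singleton] at hℓ'
  have : p ∣ ℓ := by exact_mod_cast hℓ'
  exact ((Nat.prime_dvd_prime_iff_eq hp (Fact.out)).1 this)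

end Place

end Literature.NumberTheory.EllipticCurves

namespace WeierstrassCurve

open Literature.NumberTheory.EllipticCurves

/-! ## Mathlib's local polynomial of a singular Weierstrass equation -/

section Singular

variable {K : Type u} [Field K] [NumberField K] (W : WeierstrassCurve K)

/-- For a **singular** Weierstrass equation (`Δ = 0`) Mathlib's local polynomial at any finite
place is `1 - T`, `1 + T` or `1`: the chosen "minimal" model of `W ⊗ K_v` (for `Δ = 0` every
integral model maximises `valuation_Δ_aux = 0`) has `Δ = 0`, so it never has good reduction
(`v(Δ) = 1` fails), and `localPolynomial` falls into one of its three bad-reduction branches.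
[folklore] -/
theorem localPolynomialAt_mem_of_Δ_eq_zero (hΔ : W.Δ = 0) (v : HeightOneSpectrum (𝓞 K)) :
    W.localPolynomialAt v ∈ ({1 - X, 1 + X, 1} : Set ℤ[X]) := by
  set R := v.adicCompletionIntegers K
  set W' := (W.baseChange (v.adicCompletion K)).minimal R with hW'
  have hΔ' : W'.Δ = 0 := by
    rw [hW', WeierstrassCurve.minimal, variableChange_Δ, baseChange, map_Δ, hΔ, map_zero, mul_zero]
  have hng : ¬ W'.HasGoodReduction R := by
    intro hg
    have := hg.goodReduction
    rw [hΔ', map_zero] at this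
    exact zero_ne_one this
  show localPolynomial R (W.baseChange (v.adicCompletion K)) ∈ _
  unfold localPolynomial
  rw [if_neg hng]
  split_ifs <;> simp

/-- Hence the coefficient of `T` in `L_v(W, T)` is `-1`, `1` or `0` when `Δ(W) = 0`. [folklore] -/
theorem coeff_one_localPolynomialAt_mem_of_Δ_eq_zero (hΔ : W.Δ = 0)
    (v : HeightOneSpectrum (𝓞 K)) :
    (W.localPolynomialAt v).coeff 1 ∈ ({-1, 1, 0} : Set ℤ) := by
  rcases W.localPolynomialAt_mem_of_Δ_eq_zero hΔ v with h | h | h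
  · rw [h]; simp [Polynomial.coeff_one]
  · rw [h]; simp [Polynomial.coeff_one]
  · rw [Set.mem_singleton_iff.1 h]; simp [Polynomial.coeff_one]

end Singular

end WeierstrassCurve

namespace Literature.NumberTheory.EllipticCurves

open Literature.NumberTheory.GaloisRepresentations

/-! ## The Tate module of a `Γ_K`-module isomorphic to `K̄ˣ` -/

section MultiplicativeGroup

variable {K : Type u} [Field K] [NumberField K] {M : Type u} [AddCommGroup M]
  [DistribMulAction (absoluteGaloisGroup K) M] (e : M ≃+ Additive (AlgebraicClosure K)ˣ)

omit [NumberField K] [DistribMulAction (absoluteGaloisGroup K) M] in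
/-- Transport of torsion: under `e : M ≃ K̄ˣ`, `a ∈ M[m]` iff `e(a) ^ m = 1`. [folklore] -/
theorem mem_torsionBy_iff_pow_eq_one (m : ℕ) (a : M) :
    a ∈ M[(m : ℕ)] ↔ (Additive.toMul (e a) : (AlgebraicClosure K)ˣ) ^ m = 1 := by
  rw [AddSubgroup.torsionBy.nsmul_iff, ← e.map_eq_zero_iff (x := m • a), map_nsmul]
  constructor
  · intro h
    rw [← toMul_nsmul, h, toMul_zero]
  · intro h
    rw [← ofMul_toMul (m • e a), toMul_nsmul, h, ofMul_one]

omit [NumberField K] [DistribMulAction (absoluteGaloisGroup K) M] in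
/-- Transport of torsion, on the level of `K̄`: `a ∈ M[m]` iff `e(a) ^ m = 1` in `K̄`. [folklore] -/
theorem mem_torsionBy_iff_val_pow_eq_one (m : ℕ) (a : M) :
    a ∈ M[(m : ℕ)] ↔
      ((Additive.toMul (e a) : (AlgebraicClosure K)ˣ) : AlgebraicClosure K) ^ m = 1 := by
  rw [mem_torsionBy_iff_pow_eq_one e, Units.ext_iff, Units.val_pow_eq_pow_val, Units.val_one]

omit [DistribMulAction (absoluteGaloisGroup K) M] in
/-- **`#M[ℓⁿ] = ℓⁿ` for `M ≃ K̄ˣ`**: the `ℓⁿ`-torsion of `M` is in bijection with the group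
`μ_{ℓⁿ}(K̄)` of `ℓⁿ`-th roots of unity of the algebraically closed field `K̄` of characteristic
`0`, which has exactly `ℓⁿ` elements (Mathlib `HasEnoughRootsOfUnity.natCard_rootsOfUnity`).
[folklore] -/
theorem natCard_torsionBy_eq_of_addEquiv_units (e : M ≃+ Additive (AlgebraicClosure K)ˣ)
    (ℓ : ℕ) [Fact ℓ.Prime] (n : ℕ) : Nat.card (M[(ℓ ^ n : ℕ)]) = ℓ ^ n := by
  haveI : NeZero ℓ := ⟨(Fact.out : ℓ.Prime).ne_zero⟩
  have hequiv : (M[(ℓ ^ n : ℕ)]) ≃ rootsOfUnity (ℓ ^ n) (AlgebraicClosure K) :=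
    { toFun := fun a ↦ ⟨Additive.toMul (e a),
        (mem_rootsOfUnity _ _).2 ((mem_torsionBy_iff_pow_eq_one e _ _).1 a.2)⟩
      invFun := fun ζ ↦ ⟨e.symm (Additive.ofMul (ζ : (AlgebraicClosure K)ˣ)), by
        rw [mem_torsionBy_iff_pow_eq_one e, e.apply_symm_apply, toMul_ofMul]
        exact (mem_rootsOfUnity _ _).1 ζ.2⟩
      left_inv := fun a ↦ Subtype.ext (by simp)
      right_inv := fun ζ ↦ Subtype.ext (by simp) }
  rw [Nat.card_congr hequiv]
  exact HasEnoughRootsOfUnity.natCard_rootsOfUnity (AlgebraicClosure K) (ℓ ^ n)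

variable (he : ∀ (σ : absoluteGaloisGroup K) (a : M),
  ((Additive.toMul (e (σ • a)) : (AlgebraicClosure K)ˣ) : AlgebraicClosure K) =
    σ • ((Additive.toMul (e a) : (AlgebraicClosure K)ˣ) : AlgebraicClosure K))
include he

/-- **Frobenius acts on `M[ℓⁿ] ≃ μ_{ℓⁿ}` as multiplication by `N v`.**  If `e` is
`Γ_K`-equivariant, `v ∤ ℓ`, `𝔓 ∣ v` and `σ` is an arithmetic Frobenius at `𝔓`, then
`σ • a = (N v) • a` for `a ∈ M[ℓⁿ]` (`smul_eq_pow_residueCard_of_isArithFrobAt`).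
Serre, *Abelian `ℓ`-adic representations* (1968), Ch. I §1.2, Example. [folklore] -/
theorem smul_eq_residueCard_nsmul_of_isArithFrobAt {ℓ : ℕ} [Fact ℓ.Prime]
    {v : HeightOneSpectrum (𝓞 K)} (hv : (ℓ : 𝓞 K) ∉ v.asIdeal)
    {𝔓 : Ideal (absIntegers (𝓞 K) K)} (h𝔓 : 𝔓 ∈ v.primesAbove)
    {σ : absoluteGaloisGroup K} (hσ : IsArithFrobAt (𝓞 K) σ 𝔓) {n : ℕ} {a : M}
    (ha : a ∈ M[(ℓ ^ n : ℕ)]) : σ • a = v.residueCard • a := by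
  apply e.injective
  apply Additive.toMul.injective
  apply Units.ext
  rw [he, map_nsmul, toMul_nsmul, Units.val_pow_eq_pow_val]
  exact smul_eq_pow_residueCard_of_isArithFrobAt hv h𝔓 hσ
    ((mem_torsionBy_iff_val_pow_eq_one e _ _).1 ha)

/-- **Inertia prime to `ℓ` acts trivially on `M[ℓⁿ] ≃ μ_{ℓⁿ}`**
(`smul_eq_self_of_mem_inertia_of_pow_prime_pow_eq_one`). [folklore] -/
theorem smul_eq_self_of_mem_inertia_of_mem_torsionBy {ℓ : ℕ} [Fact ℓ.Prime]
    {v : HeightOneSpectrum (𝓞 K)} (hv : (ℓ : 𝓞 K) ∉ v.asIdeal)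
    {𝔓 : Ideal (absIntegers (𝓞 K) K)} (h𝔓 : 𝔓 ∈ v.primesAbove)
    {τ : absoluteGaloisGroup K} (hτ : τ ∈ 𝔓.inertia (absoluteGaloisGroup K)) {n : ℕ} {a : M}
    (ha : a ∈ M[(ℓ ^ n : ℕ)]) : τ • a = a := by
  apply e.injective
  apply Additive.toMul.injective
  apply Units.ext
  rw [he]
  exact smul_eq_self_of_mem_inertia_of_pow_prime_pow_eq_one hv h𝔓 hτ
    ((mem_torsionBy_iff_val_pow_eq_one e _ _).1 ha)

variable (ℓ : ℕ) [Fact ℓ.Prime]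

/-- Frobenius acts on `T_ℓ M ≃ ℤ_ℓ(1)` as multiplication by `N v` (componentwise from
`smul_eq_residueCard_nsmul_of_isArithFrobAt`). [folklore] -/
theorem smul_tateModule_eq_residueCard_nsmul {v : HeightOneSpectrum (𝓞 K)}
    (hv : (ℓ : 𝓞 K) ∉ v.asIdeal) {𝔓 : Ideal (absIntegers (𝓞 K) K)} (h𝔓 : 𝔓 ∈ v.primesAbove)
    {σ : absoluteGaloisGroup K} (hσ : IsArithFrobAt (𝓞 K) σ 𝔓) (x : TateModule M ℓ) :
    σ • x = v.residueCard • x := by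
  refine TateModule.ext fun n ↦ ?_
  rw [TateModule.proj_smul_of_distribMulAction, map_nsmul]
  exact smul_eq_residueCard_nsmul_of_isArithFrobAt e he hv h𝔓 hσ
    (TateModule.proj_mem_torsionBy n x)

/-- Inertia prime to `ℓ` acts trivially on `T_ℓ M ≃ ℤ_ℓ(1)`. [folklore] -/
theorem smul_tateModule_eq_self_of_mem_inertia {v : HeightOneSpectrum (𝓞 K)}
    (hv : (ℓ : 𝓞 K) ∉ v.asIdeal) {𝔓 : Ideal (absIntegers (𝓞 K) K)} (h𝔓 : 𝔓 ∈ v.primesAbove)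
    {τ : absoluteGaloisGroup K} (hτ : τ ∈ 𝔓.inertia (absoluteGaloisGroup K))
    (x : TateModule M ℓ) : τ • x = x := by
  refine TateModule.ext fun n ↦ ?_
  rw [TateModule.proj_smul_of_distribMulAction]
  exact smul_eq_self_of_mem_inertia_of_mem_torsionBy e he hv h𝔓 hτ
    (TateModule.proj_mem_torsionBy n x)

/-- Frobenius acts on `T_ℓ M ≃ ℤ_ℓ(1)` as the scalar `N v` (as a `ℤ_ℓ`-linear map). [folklore] -/
theorem tateRepresentation_eq_smul_id_of_isArithFrobAt {v : HeightOneSpectrum (𝓞 K)}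
    (hv : (ℓ : 𝓞 K) ∉ v.asIdeal) {𝔓 : Ideal (absIntegers (𝓞 K) K)} (h𝔓 : 𝔓 ∈ v.primesAbove)
    {σ : absoluteGaloisGroup K} (hσ : IsArithFrobAt (𝓞 K) σ 𝔓) :
    tateRepresentation (absoluteGaloisGroup K) M ℓ σ = (v.residueCard : ℤ_[ℓ]) • LinearMap.id := by
  apply LinearMap.ext
  intro x
  rw [tateRepresentation_apply_apply, LinearMap.smul_apply, LinearMap.id_apply,
    Nat.cast_smul_eq_nsmul]
  exact smul_tateModule_eq_residueCard_nsmul e he ℓ hv h𝔓 hσ x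

/-- Inertia prime to `ℓ` acts trivially on `T_ℓ M ≃ ℤ_ℓ(1)` (as a `ℤ_ℓ`-linear map). [folklore] -/
theorem tateRepresentation_eq_id_of_mem_inertia {v : HeightOneSpectrum (𝓞 K)}
    (hv : (ℓ : 𝓞 K) ∉ v.asIdeal) {𝔓 : Ideal (absIntegers (𝓞 K) K)} (h𝔓 : 𝔓 ∈ v.primesAbove)
    {τ : absoluteGaloisGroup K} (hτ : τ ∈ 𝔓.inertia (absoluteGaloisGroup K)) :
    tateRepresentation (absoluteGaloisGroup K) M ℓ τ = LinearMap.id := by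
  apply LinearMap.ext
  intro x
  rw [tateRepresentation_apply_apply, LinearMap.id_apply]
  exact smul_tateModule_eq_self_of_mem_inertia e he ℓ hv h𝔓 hτ x

/-- Frobenius acts on `V_ℓ M ≃ ℚ_ℓ(1)` as the scalar `N v` (base change of
`tateRepresentation_eq_smul_id_of_isArithFrobAt`). [folklore] -/
theorem rationalTateRepresentation_eq_smul_id_of_isArithFrobAt {v : HeightOneSpectrum (𝓞 K)}
    (hv : (ℓ : 𝓞 K) ∉ v.asIdeal) {𝔓 : Ideal (absIntegers (𝓞 K) K)} (h𝔓 : 𝔓 ∈ v.primesAbove)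
    {σ : absoluteGaloisGroup K} (hσ : IsArithFrobAt (𝓞 K) σ 𝔓) :
    rationalTateRepresentation (absoluteGaloisGroup K) M ℓ σ =
      (v.residueCard : ℚ_[ℓ]) • LinearMap.id := by
  refine (TensorProduct.isBaseChange ℤ_[ℓ] (TateModule M ℓ) ℚ_[ℓ]).algHom_ext _ _ fun x ↦ ?_
  change rationalTateRepresentation (absoluteGaloisGroup K) M ℓ σ (TateModule.toRational ℓ x) =
    (v.residueCard : ℚ_[ℓ]) • TateModule.toRational ℓ x
  rw [rationalTateRepresentation_toRational, smul_tateModule_eq_residueCard_nsmul e he ℓ hv h𝔓 hσ,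
    ← Nat.cast_smul_eq_nsmul ℤ_[ℓ], map_smul, ← algebraMap_smul ℚ_[ℓ] (v.residueCard : ℤ_[ℓ]),
    map_natCast]

/-- Inertia prime to `ℓ` acts trivially on `V_ℓ M ≃ ℚ_ℓ(1)`. [folklore] -/
theorem rationalTateRepresentation_eq_id_of_mem_inertia {v : HeightOneSpectrum (𝓞 K)}
    (hv : (ℓ : 𝓞 K) ∉ v.asIdeal) {𝔓 : Ideal (absIntegers (𝓞 K) K)} (h𝔓 : 𝔓 ∈ v.primesAbove)
    {τ : absoluteGaloisGroup K} (hτ : τ ∈ 𝔓.inertia (absoluteGaloisGroup K)) :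
    rationalTateRepresentation (absoluteGaloisGroup K) M ℓ τ = LinearMap.id := by
  refine (TensorProduct.isBaseChange ℤ_[ℓ] (TateModule M ℓ) ℚ_[ℓ]).algHom_ext _ _ fun x ↦ ?_
  change rationalTateRepresentation (absoluteGaloisGroup K) M ℓ τ (TateModule.toRational ℓ x) =
    TateModule.toRational ℓ x
  rw [rationalTateRepresentation_toRational, smul_tateModule_eq_self_of_mem_inertia e he ℓ hv h𝔓 hτ]

variable (h : Continuous fun x : absoluteGaloisGroup K × RationalTateModule M ℓ ↦
  rationalTateRepresentation (absoluteGaloisGroup K) M ℓ x.1 x.2)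

/-- The inertia coinvariants of `V_ℓ M ≃ ℚ_ℓ(1)` at `𝔓 ∣ v ∤ ℓ` are all of `V_ℓ M`, a line:
`dim (V_ℓ M)_{I_𝔓} = 1` (inertia acts trivially, and `dim V_ℓ M = 1` by the torsion count
`#M[ℓⁿ] = ℓⁿ`, `RationalTateModule.finrank_eq_of_card_torsionBy`). [folklore] -/
theorem finrank_inertiaCoinvariants_eq_one {v : HeightOneSpectrum (𝓞 K)}
    (hv : (ℓ : 𝓞 K) ∉ v.asIdeal) {𝔓 : Ideal (absIntegers (𝓞 K) K)} (h𝔓 : 𝔓 ∈ v.primesAbove) :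
    Module.finrank ℚ_[ℓ] ((rationalTateGaloisRepOf M ℓ h).InertiaCoinvariants 𝔓) = 1 := by
  have hker : Representation.Coinvariants.ker
      (((rationalTateGaloisRepOf M ℓ h).restrictDecomposition 𝔓).comp
        (𝔓.inertia (𝔓.decompositionSubgroup (absoluteGaloisGroup K))).subtype) = ⊥ := by
    rw [Representation.Coinvariants.ker, Submodule.span_eq_bot]
    rintro _ ⟨⟨τ, w⟩, rfl⟩
    have hτ : ((τ : 𝔓.decompositionSubgroup (absoluteGaloisGroup K)) : absoluteGaloisGroup K) ∈
        𝔓.inertia (absoluteGaloisGroup K) :=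
      Ideal.coe_mem_inertia.2 τ.2
    show rationalTateRepresentation (absoluteGaloisGroup K) M ℓ
      ((τ : 𝔓.decompositionSubgroup (absoluteGaloisGroup K)) : absoluteGaloisGroup K) w - w = 0
    rw [rationalTateRepresentation_eq_id_of_mem_inertia e he ℓ hv h𝔓 hτ, LinearMap.id_apply,
      sub_self]
  change Module.finrank ℚ_[ℓ] (RationalTateModule M ℓ ⧸ Representation.Coinvariants.ker
    (((rationalTateGaloisRepOf M ℓ h).restrictDecomposition 𝔓).comp
      (𝔓.inertia (𝔓.decompositionSubgroup (absoluteGaloisGroup K))).subtype)) = 1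
  refine (LinearEquiv.finrank_eq (Submodule.quotEquivOfEqBot _ hker)).trans ?_
  exact RationalTateModule.finrank_eq_of_card_torsionBy (d := 1) fun n ↦ by
    rw [one_mul]; exact natCard_torsionBy_eq_of_addEquiv_units e ℓ n

/-- Frobenius acts on the inertia coinvariants of `V_ℓ M ≃ ℚ_ℓ(1)` as the scalar `N v`.
[folklore] -/
theorem toInertiaCoinvariants_eq_smul_id {v : HeightOneSpectrum (𝓞 K)}
    (hv : (ℓ : 𝓞 K) ∉ v.asIdeal) {𝔓 : Ideal (absIntegers (𝓞 K) K)} (h𝔓 : 𝔓 ∈ v.primesAbove)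
    (σ : 𝔓.decompositionSubgroup (absoluteGaloisGroup K))
    (hσ : IsArithFrobAt (𝓞 K) (σ : absoluteGaloisGroup K) 𝔓) :
    (rationalTateGaloisRepOf M ℓ h).toInertiaCoinvariants 𝔓 σ =
      (v.residueCard : ℚ_[ℓ]) • LinearMap.id := by
  apply LinearMap.ext
  intro c
  induction c using Representation.Coinvariants.induction_on with
  | h w =>
    rw [ContinuousRep.toInertiaCoinvariants_mk, LinearMap.smul_apply, LinearMap.id_apply,
      ← map_smul]
    congr 1
    show rationalTateRepresentation (absoluteGaloisGroup K) M ℓ (σ : absoluteGaloisGroup K) w = _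
    rw [rationalTateRepresentation_eq_smul_id_of_isArithFrobAt e he ℓ hv h𝔓 hσ,
      LinearMap.smul_apply, LinearMap.id_apply]

/-- **The Euler factor of the Tate module of the multiplicative group.**  Let `M` be a
`Γ_K`-module with a `Γ_K`-equivariant isomorphism `e : M ≃ K̄ˣ` (so `T_ℓ M = ℤ_ℓ(1)`,
`V_ℓ M = ℚ_ℓ(1)`).  Then for every prime `ℓ`, every finite place `v ∤ ℓ` and every continuity
witness `h`, the `ℓ`-adic Hasse–Weil Euler factor of `M` at `v`
(`Literature.NumberTheory.EllipticCurves.hasseWeilEulerFactor`: arithmetic Frobenius on the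
inertia coinvariants) is `det(1 - σ_v T ∣ ℚ_ℓ(1)) = 1 - (N v) T`: the cyclotomic character is
unramified at `v` with `χ_ℓ(Frob_v) = N v`.
Serre, *Abelian `ℓ`-adic representations* (1968), Ch. I §1.2, Example (`V_ℓ(G_m)`,
`χ_ℓ(F_v) = Nv`). [folklore] -/
theorem hasseWeilEulerFactor_eq_of_addEquiv_units [Module.Finite ℚ_[ℓ] (RationalTateModule M ℓ)]
    {v : HeightOneSpectrum (𝓞 K)} (hv : (ℓ : 𝓞 K) ∉ v.asIdeal) :
    hasseWeilEulerFactor M ℓ h v = 1 - C (v.residueCard : ℚ_[ℓ]) * X :=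
  hasseWeilEulerFactor_eq_of_finrank_eq_one M ℓ h v _ fun h𝔓 ↦
    ⟨finrank_inertiaCoinvariants_eq_one e he ℓ h hv h𝔓,
      fun σ hσ ↦ toInertiaCoinvariants_eq_smul_id e he ℓ h hv h𝔓 σ hσ⟩

end MultiplicativeGroup

end Literature.NumberTheory.EllipticCurves

/-! ## Split nodal cubics -/

namespace WeierstrassCurve

open Literature.NumberTheory.EllipticCurves Literature.NumberTheory.GaloisRepresentations

section PointCongr

variable {k : Type u} [Field k] [DecidableEq k]

/-- For a Weierstrass cubic that *equals* a singular model with a node (`α₁ ≠ α₂`) there is a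
group isomorphism `E_ns ≃ kˣ` given on affine points by Silverman's formula
`(x, y) ↦ (y - y₀ - α₁(x - x₀))/(y - y₀ - α₂(x - x₀))` (`singularModel.nodeEquiv`, transported
along the equality of curves).  Silverman, *AEC*, Prop. III.2.5(a). [folklore] -/
theorem exists_addEquiv_units_of_eq_singularModel {V : WeierstrassCurve k} {x₀ y₀ α₁ α₂ : k}
    (hV : V = singularModel x₀ y₀ α₁ α₂) (hα : α₁ ≠ α₂) :
    ∃ e : V.toAffine.Point ≃+ Additive kˣ, ∀ (x y : k) (hP : V.toAffine.Nonsingular x y),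
      ((Additive.toMul (e (.some x y hP)) : kˣ) : k) =
        (y - y₀ - α₁ * (x - x₀)) / (y - y₀ - α₂ * (x - x₀)) := by
  subst hV
  exact ⟨singularModel.nodeEquiv hα, fun x y hP ↦ rfl⟩

end PointCongr

section Nodal

variable {K : Type u} [Field K] [NumberField K] (x₀ y₀ α₁ α₂ : K)

/-- The base change of the singular model to `K̄` is the singular model with the same (embedded)
parameters. [folklore] -/
theorem baseChange_singularModel :
    (singularModel x₀ y₀ α₁ α₂).baseChange (AlgebraicClosure K) =
      singularModel (algebraMap K (AlgebraicClosure K) x₀) (algebraMap K (AlgebraicClosure K) y₀)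
        (algebraMap K (AlgebraicClosure K) α₁) (algebraMap K (AlgebraicClosure K) α₂) := by
  ext <;> simp only [singularModel, baseChange, map_a₁, map_a₂, map_a₃, map_a₄, map_a₆, map_neg,
    map_add, map_sub, map_mul, map_pow, map_ofNat]

variable {α₁ α₂} (hα : α₁ ≠ α₂)
include hα

/-- **The geometric points of a split nodal cubic are `K̄ˣ`, `Γ_K`-equivariantly.**  For the
singular model `W = singularModel x₀ y₀ α₁ α₂` over `K` with a node (`α₁ ≠ α₂`; both tangent
slopes `αᵢ` lie in `K`: a *split* node), Silverman's isomorphism `E_ns(K̄) ≃ K̄ˣ`,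
`(x, y) ↦ (y - y₀ - α₁(x - x₀))/(y - y₀ - α₂(x - x₀))`, commutes with `Gal(K̄/K)` (the formula
has coefficients in `K`).  Silverman, *AEC*, Prop. III.2.5(a) and Exercise 3.5. [folklore] -/
theorem exists_equivariant_addEquiv_units_geomPoints_singularModel :
    ∃ e : geomPoints (singularModel x₀ y₀ α₁ α₂) ≃+ Additive (AlgebraicClosure K)ˣ,
      ∀ (σ : absoluteGaloisGroup K) (P : geomPoints (singularModel x₀ y₀ α₁ α₂)),
        ((Additive.toMul (e (σ • P)) : (AlgebraicClosure K)ˣ) : AlgebraicClosure K) =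
          σ • ((Additive.toMul (e P) : (AlgebraicClosure K)ˣ) : AlgebraicClosure K) := by
  have hα' : algebraMap K (AlgebraicClosure K) α₁ ≠ algebraMap K (AlgebraicClosure K) α₂ :=
    fun h ↦ hα ((algebraMap K (AlgebraicClosure K)).injective h)
  obtain ⟨e, he⟩ := exists_addEquiv_units_of_eq_singularModel
    (baseChange_singularModel x₀ y₀ α₁ α₂) hα'
  refine ⟨e, fun σ P ↦ ?_⟩
  set σ' : AlgebraicClosure K ≃ₐ[K] AlgebraicClosure K := absoluteGaloisGroup.toAlgEquiv K σ
  have hsmul : ∀ t : AlgebraicClosure K, σ • t = σ' t := fun t ↦ rfl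
  change ((singularModel x₀ y₀ α₁ α₂).baseChange (AlgebraicClosure K)).toAffine.Point at P
  rcases P with _ | ⟨x, y, hP⟩
  · show ((Additive.toMul (e (Affine.Point.map (σ' : AlgebraicClosure K →ₐ[K] AlgebraicClosure K)
        0)) : (AlgebraicClosure K)ˣ) : AlgebraicClosure K) =
      σ • ((Additive.toMul (e 0) : (AlgebraicClosure K)ˣ) : AlgebraicClosure K)
    rw [Affine.Point.map_zero, map_zero, toMul_zero, Units.val_one, smul_one]
  · show ((Additive.toMul (e (Affine.Point.map (σ' : AlgebraicClosure K →ₐ[K] AlgebraicClosure K)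
        (Affine.Point.some x y hP))) : (AlgebraicClosure K)ˣ) : AlgebraicClosure K) =
      σ • ((Additive.toMul (e (Affine.Point.some x y hP)) : (AlgebraicClosure K)ˣ) :
        AlgebraicClosure K)
    rw [Affine.Point.map_some, he, he, hsmul, map_div₀]
    simp only [AlgEquiv.coe_toAlgHom, map_sub, map_mul, AlgEquiv.commutes]

variable (ℓ : ℕ) [Fact ℓ.Prime]

/-- `#E_ns(K̄)[ℓⁿ] = ℓⁿ` for a split nodal cubic (`E_ns(K̄) ≃ K̄ˣ`). [folklore] -/
theorem natCard_geomTorsion_singularModel (n : ℕ) :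
    Nat.card ((geomPoints (singularModel x₀ y₀ α₁ α₂))[(ℓ ^ n : ℕ)]) = ℓ ^ (1 * n) := by
  obtain ⟨e, -⟩ := exists_equivariant_addEquiv_units_geomPoints_singularModel x₀ y₀ hα
  rw [one_mul]
  exact natCard_torsionBy_eq_of_addEquiv_units e ℓ n

/-- `V_ℓ` of a split nodal cubic is finite-dimensional (a line). [folklore] -/
theorem module_finite_rationalTateModule_singularModel :
    Module.Finite ℚ_[ℓ] ((singularModel x₀ y₀ α₁ α₂).rationalTateModule ℓ) :=
  RationalTateModule.finite_of_card_torsionBy_rank (natCard_geomTorsion_singularModel x₀ y₀ hα ℓ)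

/-- `T_ℓ` of a split nodal cubic is finitely generated over `ℤ_ℓ`. [folklore] -/
theorem module_finite_tateModule_singularModel :
    Module.Finite ℤ_[ℓ] ((singularModel x₀ y₀ α₁ α₂).tateModule ℓ) :=
  TateModule.finite_of_card_torsionBy_rank (natCard_geomTorsion_singularModel x₀ y₀ hα ℓ)

/-- The Galois action on `V_ℓ` of a split nodal cubic is jointly continuous
(`Literature.NumberTheory.EllipticCurves.continuous_rationalTateRepresentation`: `E_ns(K̄)` is a
discrete `Γ_K`-module and `T_ℓ` is finitely generated). [folklore] -/
theorem continuous_rationalTateRepresentation_singularModel :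
    Continuous fun x : absoluteGaloisGroup K ×
        RationalTateModule (geomPoints (singularModel x₀ y₀ α₁ α₂)) ℓ ↦
      rationalTateRepresentation (absoluteGaloisGroup K)
        (geomPoints (singularModel x₀ y₀ α₁ α₂)) ℓ x.1 x.2 := by
  haveI := continuousSMul_geomPoints' (singularModel x₀ y₀ α₁ α₂)
  haveI : Module.Finite ℤ_[ℓ] (TateModule (geomPoints (singularModel x₀ y₀ α₁ α₂)) ℓ) :=
    module_finite_tateModule_singularModel x₀ y₀ hα ℓ
  exact continuous_rationalTateRepresentation ℓ

/-- **The Euler factors of a split nodal cubic.**  For `W = singularModel x₀ y₀ α₁ α₂` over a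
number field with `α₁ ≠ α₂`, every prime `ℓ`, every continuity / finiteness witness and every
finite place `v ∤ ℓ`: `det(1 - σ_v T ∣ (V_ℓ E_ns(K̄))_{I_v}) = 1 - (N v) T`
(`hasseWeilEulerFactor_eq_of_addEquiv_units` with the equivariant `E_ns(K̄) ≃ K̄ˣ`). [folklore] -/
theorem hasseWeilEulerFactor_geomPoints_singularModel
    (h : Continuous fun x : absoluteGaloisGroup K ×
        RationalTateModule (geomPoints (singularModel x₀ y₀ α₁ α₂)) ℓ ↦
      rationalTateRepresentation (absoluteGaloisGroup K)
        (geomPoints (singularModel x₀ y₀ α₁ α₂)) ℓ x.1 x.2)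
    [Module.Finite ℚ_[ℓ] ((singularModel x₀ y₀ α₁ α₂).rationalTateModule ℓ)]
    {v : HeightOneSpectrum (𝓞 K)} (hv : (ℓ : 𝓞 K) ∉ v.asIdeal) :
    hasseWeilEulerFactor (geomPoints (singularModel x₀ y₀ α₁ α₂)) ℓ h v =
      1 - C (v.residueCard : ℚ_[ℓ]) * X := by
  obtain ⟨e, he⟩ := exists_equivariant_addEquiv_units_geomPoints_singularModel x₀ y₀ hα
  exact hasseWeilEulerFactor_eq_of_addEquiv_units e he ℓ h hv

/-- **The Euler-factor identity fails for a split nodal cubic at every `v ∤ ℓ`.**  The left-hand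
side of `hasseWeilEulerFactor_geomPoints` is `1 - (N v) T` with `N v ≥ 2`, while Mathlib's local
polynomial of the singular equation is `1 - T`, `1 + T` or `1`
(`localPolynomialAt_mem_of_Δ_eq_zero`): compare the coefficients of `T`. [folklore] -/
theorem hasseWeilEulerFactor_geomPoints_singularModel_ne
    (h : Continuous fun x : absoluteGaloisGroup K ×
        RationalTateModule (geomPoints (singularModel x₀ y₀ α₁ α₂)) ℓ ↦
      rationalTateRepresentation (absoluteGaloisGroup K)
        (geomPoints (singularModel x₀ y₀ α₁ α₂)) ℓ x.1 x.2)
    [Module.Finite ℚ_[ℓ] ((singularModel x₀ y₀ α₁ α₂).rationalTateModule ℓ)]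
    {v : HeightOneSpectrum (𝓞 K)} (hv : (ℓ : 𝓞 K) ∉ v.asIdeal) :
    hasseWeilEulerFactor (geomPoints (singularModel x₀ y₀ α₁ α₂)) ℓ h v ≠
      ((singularModel x₀ y₀ α₁ α₂).localPolynomialAt v).map (Int.castRingHom ℚ_[ℓ]) := by
  intro H
  have h1 := congrArg (fun P : ℚ_[ℓ][X] ↦ P.coeff 1) H
  simp only [hasseWeilEulerFactor_geomPoints_singularModel x₀ y₀ hα ℓ h hv, Polynomial.coeff_map,
    eq_intCast, coeff_sub, Polynomial.coeff_one, one_ne_zero, if_false, coeff_C_mul, coeff_X_one,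
    mul_one, zero_sub] at h1
  have hq : 1 < v.residueCard := v.one_lt_residueCard
  rcases (singularModel x₀ y₀ α₁ α₂).coeff_one_localPolynomialAt_mem_of_Δ_eq_zero
    (singularModel.Δ_eq x₀ y₀ α₁ α₂) v with hc | hc | hc
  · rw [hc] at h1
    have : (v.residueCard : ℚ_[ℓ]) = 1 := by
      have := congrArg Neg.neg h1; push_cast at this; simpa using this
    exact hq.ne' (by exact_mod_cast this)
  · rw [hc] at h1
    have : ((v.residueCard + 1 : ℕ) : ℚ_[ℓ]) = 0 := by push_cast; linear_combination -h1
    exact Nat.succ_ne_zero v.residueCard (by exact_mod_cast this)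
  · rw [Set.mem_singleton_iff.1 hc] at h1
    have : (v.residueCard : ℚ_[ℓ]) = 0 := by simpa using h1
    exact (zero_lt_one.trans hq).ne' (by exact_mod_cast this)

/-- **Refutation of the per-`ℓ` schema on split nodal cubics.**  For every number field `K`,
every split nodal cubic `W = singularModel x₀ y₀ α₁ α₂` (`α₁ ≠ α₂`) over `K` and every prime
`ℓ`, the schema `W.hasseWeilEulerFactor_geomPoints ℓ` of `HasseWeilAbelian` (stated without
`[W.IsElliptic]`) is **false**: continuity and finiteness witnesses exist
(`continuous_rationalTateRepresentation_singularModel`,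
`module_finite_rationalTateModule_singularModel`), a place `v ∤ ℓ` exists
(`exists_heightOneSpectrum_natCast_notMem`), and there the identity fails
(`hasseWeilEulerFactor_geomPoints_singularModel_ne`).  The corrected (elliptic) statements are
unaffected. [folklore] -/
theorem not_hasseWeilEulerFactor_geomPoints_singularModel :
    ¬ (singularModel x₀ y₀ α₁ α₂).hasseWeilEulerFactor_geomPoints ℓ := by
  intro H
  obtain ⟨v, hv⟩ := exists_heightOneSpectrum_natCast_notMem K ℓ
  haveI := module_finite_rationalTateModule_singularModel x₀ y₀ hα ℓ
  exact hasseWeilEulerFactor_geomPoints_singularModel_ne x₀ y₀ hα ℓ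
    (continuous_rationalTateRepresentation_singularModel x₀ y₀ hα ℓ) hv
    (H (continuous_rationalTateRepresentation_singularModel x₀ y₀ hα ℓ) inferInstance v hv)

omit [Fact ℓ.Prime] in
/-- **Refutation of the schema `hasRationalEulerFactors_geomPoints` on split nodal cubics**: for
every number field `K` and every split nodal cubic `W = singularModel x₀ y₀ α₁ α₂` (`α₁ ≠ α₂`)
over `K`, `W.hasRationalEulerFactors_geomPoints` is **false** (take `ℓ = 2` in
`not_hasseWeilEulerFactor_geomPoints_singularModel`; the family `ℤ[T] → ℚ[T] → ℚ_ℓ[T]` is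
`ℤ[T] → ℚ_ℓ[T]`).  Hence the named fact of `HasseWeilAbelian` must carry `[W.IsElliptic]`
(`hasRationalEulerFactors_geomPoints_of_isElliptic`). [folklore] -/
theorem not_hasRationalEulerFactors_geomPoints_singularModel :
    ¬ (singularModel x₀ y₀ α₁ α₂).hasRationalEulerFactors_geomPoints := by
  intro H
  haveI : Fact (Nat.Prime 2) := ⟨Nat.prime_two⟩
  refine not_hasseWeilEulerFactor_geomPoints_singularModel x₀ y₀ hα 2 fun h hfin v hv ↦ ?_
  have := H 2 h hfin v (Set.notMem_empty v) hv
  rw [Polynomial.map_map, RingHom.ext_int ((algebraMap ℚ ℚ_[2]).comp (Int.castRingHom ℚ))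
    (Int.castRingHom ℚ_[2])] at this
  exact this.symm

end Nodal

end WeierstrassCurve
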